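import Literature.NumberTheory.Automorphic.UnitaryGroupAutomorphicMeasure
import Literature.NumberTheory.Automorphic.AdelicUnitaryGroupMeasureUniqueness
import HarnessLib

/-!
# Automorphic measures for the unitary groups of the standard forms over a CM field — in
# particular Mok's quasi-split `U_{L/L⁺}(N) = U(J_N)`

Topic `NumberTheory/Automorphic`; namespace `Literature.NumberTheory.Automorphic.UnitaryGroup`.
Proof file (theorems only). For a CM field `L` (complex conjugation `c`, maximal totally real subfield
`L⁺`) and a standard form `S : StdForm N` (an integer matrix `J₀` with `J₀ᵀ = J₀`, `J₀² = 1`: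
`StdForm.antidiagonal N` = Mok's `J_N`, the signature forms, `1`), the matrix `S.over L` is hermitian
for `c` (its entries are integers) with unit determinant, so the unconditional Borel–Harish-Chandra
theorem of the tree (`exists_isAutomorphicMeasure_cmDatum_of_isHermitian`, orbit-count unfolding) and
the uniqueness theorem (`isAutomorphicMeasure_unique_smul_cmDatum`) apply to the generic unitary datum
`UnitaryGroup.adelicGroupData L⁺ L c N (S.over L)` (which is `cmDatum L N (S.over L)` by `rfl`,
`adelicGroupData_eq_cmDatum`):

* `stdForm_over_isHermitian`, `stdForm_over_det_ne_zero`;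
* `exists_isAutomorphicMeasure_adelicGroupData_stdForm`, `isAutomorphicMeasure_unique_smul_adelicGroupData_stdForm`;
* `exists_isAutomorphicMeasure_quasiSplit`, `isAutomorphicMeasure_unique_smul_quasiSplit` — **Mok's
  quasi-split unitary group `UnitaryGroup.quasiSplit L⁺ L c N` has an automorphic measure, unique up to
  a positive scalar**, for every `N` (the datum on which the tree's `CuspCondition`, Whittaker
  coefficients and genericity for `U_{E/F}(N)` are typed, at the CM pair `(L⁺, L)`).

Borel (1963), §5, Thm. 5.8; Mok (2014), §1 (the group `U_{E/F}(N)`).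

## References

* A. Borel, *Some finiteness properties of adele groups over number fields*, Publ. Math. IHÉS 16
  (1963), §5, Thm. 5.8 [Borel1963].
* C. P. Mok, *Endoscopic classification of representations of quasi-split unitary groups*, Mem. AMS
  235 (2015), §1 [Mok2014].
-/

noncomputable section

open MeasureTheory Measure NumberField IsDedekindDomain Matrix Set
open scoped MatrixGroups ENNReal NNReal

namespace Literature.NumberTheory.Automorphic

namespace UnitaryGroup

variable (L : Type) [Field L] [NumberField L] [IsCMField L] (N : ℕ) (S : StdForm N)

/-- A standard form is hermitian for the CM conjugation: `ᵗ(c (S.over L)) = S.over L` (integer entries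
are fixed by `c`, and `J₀ᵀ = J₀`). [folklore] -/
private theorem stdForm_over_isHermitian : ((S.over L).map (cmConjRingHom L))ᵀ = S.over L := by
  rw [StdForm.over_map, StdForm.transpose_over]

omit [NumberField L] [IsCMField L] in
/-- A standard form has non-zero determinant over `L` (`J₀² = 1`). [folklore] -/
private theorem stdForm_over_det_ne_zero : (S.over L).det ≠ 0 :=
  ((Matrix.isUnit_iff_isUnit_det _).1 (S.isUnit_over L)).ne_zero

/-- **Automorphic measure for the unitary group of a standard form over a CM field.** For every
`S : StdForm N` the automorphic quotient of `UnitaryGroup.adelicGroupData L⁺ L c N (S.over L)` —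
`U(S)(𝔸_{L⁺}) ⧸ U(S)(L⁺)` — carries an automorphic measure (finite, positive on non-empty open sets,
inner regular, invariant): Borel (1963), Thm. 5.8, via `exists_isAutomorphicMeasure_cmDatum_of_isHermitian`
and `adelicGroupData_eq_cmDatum`. [cite: Borel1963, Thm. 5.8] -/
theorem exists_isAutomorphicMeasure_adelicGroupData_stdForm :
    ∃ μ' : Measure (adelicGroupData ↥(maximalRealSubfield L) L (IsCMField.complexConj L) N
        (S.over L)).automorphicQuotient,
      (adelicGroupData ↥(maximalRealSubfield L) L (IsCMField.complexConj L) N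
        (S.over L)).IsAutomorphicMeasure μ' := by
  rw [adelicGroupData_eq_cmDatum]
  exact exists_isAutomorphicMeasure_cmDatum_of_isHermitian L N (S.over L)
    (stdForm_over_isHermitian L N S) (stdForm_over_det_ne_zero L N S)

/-- Uniqueness up to a positive scalar of the automorphic measure for the unitary group of a standard
form over a CM field (`isAutomorphicMeasure_unique_smul_cmDatum`). [cite: Borel1963, §5] -/
theorem isAutomorphicMeasure_unique_smul_adelicGroupData_stdForm
    (μ ν : Measure (adelicGroupData ↥(maximalRealSubfield L) L (IsCMField.complexConj L) N
        (S.over L)).automorphicQuotient)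
    [(adelicGroupData ↥(maximalRealSubfield L) L (IsCMField.complexConj L) N
        (S.over L)).IsAutomorphicMeasure μ]
    [(adelicGroupData ↥(maximalRealSubfield L) L (IsCMField.complexConj L) N
        (S.over L)).IsAutomorphicMeasure ν] :
    ∃ c : ℝ≥0, c ≠ 0 ∧ μ = c • ν := by
  haveI : LocallyCompactSpace (adelicGroupData ↥(maximalRealSubfield L) L (IsCMField.complexConj L) N
      (S.over L)).Adelic := locallyCompactSpace_cmDatum_Adelic L N (S.over L)
  haveI : SecondCountableTopology (adelicGroupData ↥(maximalRealSubfield L) L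
      (IsCMField.complexConj L) N (S.over L)).Adelic := secondCountableTopology_cmDatum_Adelic L N (S.over L)
  haveI : T2Space (adelicGroupData ↥(maximalRealSubfield L) L (IsCMField.complexConj L) N
      (S.over L)).Adelic := t2Space_cmDatum_Adelic L N (S.over L)
  have h := adelicGroupData_eq_cmDatum L N (S.over L)
  exact AdelicGroupData.isAutomorphicMeasure_unique_smul_of_isClosed _
    (by rw [h, cmDatum_quotientSubgroup]; exact isClosed_adelicUnitaryRat L N (S.over L)) μ ν

/-- **Mok's quasi-split unitary group `U_{L/L⁺}(N) = U(J_N)` has an automorphic measure** (every `N`):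
the automorphic quotient of `UnitaryGroup.quasiSplit L⁺ L c N` carries a finite, invariant, inner
regular measure positive on non-empty open sets — finite covolume of `U(J_N)(L⁺)` in `U(J_N)(𝔸_{L⁺})`
(Borel (1963), Thm. 5.8; the group of Mok (2014), §1). [cite: Borel1963, Thm. 5.8] -/
theorem exists_isAutomorphicMeasure_quasiSplit :
    ∃ μ' : Measure (quasiSplit ↥(maximalRealSubfield L) L (IsCMField.complexConj L) N).automorphicQuotient,
      (quasiSplit ↥(maximalRealSubfield L) L (IsCMField.complexConj L) N).IsAutomorphicMeasure μ' :=
  exists_isAutomorphicMeasure_adelicGroupData_stdForm L N (StdForm.antidiagonal N)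

/-- Uniqueness up to a positive scalar of the automorphic measure of `U_{L/L⁺}(N)`. [cite: Borel1963, §5] -/
theorem isAutomorphicMeasure_unique_smul_quasiSplit
    (μ ν : Measure (quasiSplit ↥(maximalRealSubfield L) L (IsCMField.complexConj L) N).automorphicQuotient)
    [(quasiSplit ↥(maximalRealSubfield L) L (IsCMField.complexConj L) N).IsAutomorphicMeasure μ]
    [(quasiSplit ↥(maximalRealSubfield L) L (IsCMField.complexConj L) N).IsAutomorphicMeasure ν] :
    ∃ c : ℝ≥0, c ≠ 0 ∧ μ = c • ν :=
  isAutomorphicMeasure_unique_smul_adelicGroupData_stdForm L N (StdForm.antidiagonal N) μ ν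

end UnitaryGroup

end Literature.NumberTheory.Automorphic
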